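import Mathlib

/-!
# Cohn's odd-exponent lemma for `y² + 1 = 2·zⁿ` — the Gaussian-integer half (Part A)

J. H. E. Cohn, *Perfect Pell powers*, Glasgow Math. J. **38** (1996) 19–20, LEMMA, first half of the proof
(p. 19): if `y² + 1 = 2·zⁿ` with `n` odd and `z > 0`, then factorising `(y+i)(y−i) = (1+i)(1−i)·zⁿ` in `ℤ[i]`
gives `y + i = (1+i)(a+ib)ⁿ` (units absorbed because `n` is odd) and `z = a² + b²`; comparing with
`1 + i = (a+ib)ⁿ + (−1)^K (ia+b)ⁿ` (`n = 2K+1`) and using `A + B ∣ Aⁿ + Bⁿ` (resp. `A − B ∣ Aⁿ − Bⁿ`) yields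
`a + b = ±1` (resp. `a − b = ±1`), hence `2z = c² + 1` with `c = 2a ± 1`.

This file is PROOF-ONLY (no definitions, no named facts, no `sorry`): generic `ℤ[i]` lemmas
(`GaussianInt.pow_four_eq_one_of_isUnit`, `GaussianInt.exists_eq_pow_of_associated_pow_of_odd`) and the
Part-A conclusion `exists_sq_add_one_eq_two_mul_of_sq_add_one_eq_two_mul_pow`
(`y² + 1 = 2zⁿ`, `n` odd, `z > 0` ⇒ `∃ c, c² + 1 = 2z`), exported for the exponent `2K+1` under the
skeleton name `cohn_exists_sq_add_one_eq_two_mul` (stub (A) of lead abc-inputs-pr-2's COHN-ODD skeleton). The second half of Cohn's proof (the negative Pell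
equation `u² − (c²+1)v² = −1` and the `p`-adic count, p. 20) lives in a sibling file. Cell abc-inputs, row I-03
(odd half) of `pub/abc-inputs/INPUTS-LIST.md`; serves `stmt-ABC-24025` (family (ii) of `SolvedZooABC`) — it does
not close it. HONESTY: an elementary Diophantine lemma; abc is not touched (abc moved by 0; NOT abc).
-/

-- `Summit.<Summit>.<Problem>` is the mandated summit-side namespace (CONVENTIONS §2); for the
-- single-conjunct summit `ABC` the two coincide, so the duplicate `ABC.ABC` is deliberate.
set_option linter.dupNamespace false

namespace Summit.ABC.ABC.Theorems

open Zsqrtd GaussianInt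

/-- Every unit `u` of `ℤ[i]` satisfies `u⁴ = 1` (the units are `±1, ±i`). [folklore] -/
theorem GaussianInt.pow_four_eq_one_of_isUnit {u : GaussianInt} (hu : IsUnit u) : u ^ 4 = 1 := by
  have h1 : u.norm = 1 := (Zsqrtd.norm_eq_one_iff' (by norm_num) u).mpr hu
  obtain ⟨re, im⟩ := u
  rw [Zsqrtd.norm_def] at h1
  simp only at h1
  have hre : -1 ≤ re ∧ re ≤ 1 := by constructor <;> nlinarith [sq_nonneg im, sq_nonneg re]
  have him : -1 ≤ im ∧ im ≤ 1 := by constructor <;> nlinarith [sq_nonneg im, sq_nonneg re]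
  obtain ⟨hre1, hre2⟩ := hre
  obtain ⟨him1, him2⟩ := him
  interval_cases re <;> interval_cases im <;> first | (exfalso; omega) | decide

/-- In `ℤ[i]`, an element associated to an `n`-th power with `n` odd IS an `n`-th power: the unit `u`
(with `u⁴ = 1`) is absorbed as `u = (uⁿ)ⁿ` since `n² ≡ 1 (mod 4)`. (Cohn 1996, p. 19: "any units, i.e. powers
of `i`, can be absorbed".) [folklore] -/
theorem GaussianInt.exists_eq_pow_of_associated_pow_of_odd {α β : GaussianInt} {n : ℕ} (hn : Odd n)
    (h : Associated (α ^ n) β) : ∃ γ : GaussianInt, β = γ ^ n := by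
  obtain ⟨u, hu⟩ := h
  refine ⟨α * (u : GaussianInt) ^ n, ?_⟩
  have h4 : (u : GaussianInt) ^ 4 = 1 := GaussianInt.pow_four_eq_one_of_isUnit u.isUnit
  obtain ⟨m, rfl⟩ := hn
  have hpow : ((u : GaussianInt) ^ (2 * m + 1)) ^ (2 * m + 1) = u := by
    rw [← pow_mul, show (2 * m + 1) * (2 * m + 1) = 4 * (m * m + m) + 1 by ring, pow_succ, pow_mul, h4,
      one_pow, one_mul]
  rw [mul_pow, hpow, hu]

/-- **Cohn 1996, Lemma, first half (p. 19).** If `y² + 1 = 2·zⁿ` with `n` odd and `z > 0`, then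
`z = a² + b²` for integers `a, b` with `a + b = ±1` or `a − b = ±1`.
Proof: `y = 2t+1`; `β := (t+1) − t·i` has `β·β̄ = zⁿ` and is coprime to `β̄` (`2 = β(1−i) + β̄(1+i)`, `zⁿ` odd);
so `β = γⁿ` (`ℤ[i]` is a PID; units absorbed, `n` odd), `z = N(γ) = a² + b²`; with `B := b + a i = i·γ̄`,
`γⁿ + (−1)^K Bⁿ = 1 + i` (`n = 2K+1`), and `γ + B = (a+b)(1+i) ∣ 1 + i` for `K` even,
`γ − B = (a−b)(1−i) ∣ 1 + i = i(1−i)` for `K` odd. [cite: Cohn1996PerfectPellPowers, Lemma, p. 19] -/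
theorem exists_sq_add_sq_eq_of_sq_add_one_eq_two_mul_pow {y z : ℤ} {n : ℕ} (hn : Odd n) (hz : 0 < z)
    (h : y ^ 2 + 1 = 2 * z ^ n) :
    ∃ a b : ℤ, a ^ 2 + b ^ 2 = z ∧ ((a + b) ^ 2 = 1 ∨ (a - b) ^ 2 = 1) := by
  have hn0 : n ≠ 0 := by rintro rfl; exact (Nat.not_odd_iff_even.mpr Even.zero) hn
  -- `y` is odd, `y = 2t + 1`
  have hyodd : Odd y := by
    have h2 : Even (y ^ 2 + 1) := ⟨z ^ n, by rw [h]; ring⟩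
    rw [Int.even_add_one, Int.even_pow] at h2
    exact Int.not_even_iff_odd.mp fun hy => h2 ⟨hy, two_ne_zero⟩
  obtain ⟨t, rfl⟩ := hyodd
  have hN : z ^ n = t ^ 2 + (t + 1) ^ 2 := by
    have h2 : 2 * z ^ n = 2 * (t ^ 2 + (t + 1) ^ 2) := by rw [← h]; ring
    exact mul_left_cancel₀ two_ne_zero h2
  -- the Gaussian integer `β = (t+1) - t i`, with `β · star β = z ^ n`
  set β : GaussianInt := ⟨t + 1, -t⟩ with hβ
  have hprod : β * star β = (z : GaussianInt) ^ n := by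
    rw [← Int.cast_pow, hN, Zsqrtd.intCast_val]
    ext <;> simp [β] <;> ring
  have hcop : IsCoprime β (star β) := by
    refine ⟨⟨1 - t ^ 2, t ^ 2 + 2 * t⟩, ⟨-(t ^ 2 + t), -(t ^ 2 + t)⟩, ?_⟩
    ext <;> simp [β] <;> ring
  obtain ⟨α, hα⟩ := exists_associated_pow_of_mul_eq_pow' hcop hprod
  obtain ⟨γ, hγ⟩ := GaussianInt.exists_eq_pow_of_associated_pow_of_odd hn hα
  refine ⟨γ.re, γ.im, ?_, ?_⟩
  · -- norms: `z ^ n = N(β) = N(γ) ^ n`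
    have h1 : β.norm = z ^ n := by rw [hN, Zsqrtd.norm_def]; simp [β]; ring
    have h2 : β.norm = γ.norm ^ n := by rw [hγ]; exact map_pow Zsqrtd.normMonoidHom γ n
    have h3 : γ.norm = z := (pow_left_inj₀ (GaussianInt.norm_nonneg γ) hz.le hn0).mp (h2.symm.trans h1)
    rw [Zsqrtd.norm_def] at h3
    linarith
  · obtain ⟨K, rfl⟩ := hn
    set B : GaussianInt := ⟨γ.im, γ.re⟩ with hBdef
    have hB : B = ⟨0, 1⟩ * star γ := by ext <;> simp [B]
    have hi : (⟨0, 1⟩ : GaussianInt) ^ (2 * K + 1) = (-1) ^ K * ⟨0, 1⟩ := by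
      rw [pow_succ, pow_mul, show (⟨0, 1⟩ : GaussianInt) ^ 2 = -1 by decide]
    have hBn : B ^ (2 * K + 1) = (-1) ^ K * (⟨0, 1⟩ * star β) := by
      rw [hB, mul_pow, ← star_pow, ← hγ, hi, mul_assoc]
    have key : γ ^ (2 * K + 1) + (-1) ^ K * B ^ (2 * K + 1) = ⟨1, 1⟩ := by
      rw [hBn, ← hγ, ← mul_assoc, ← mul_pow, neg_one_mul, neg_neg, one_pow, one_mul]
      ext <;> simp [β]
    -- an integer `s` with `(s : ℤ[i]) ∣ 1` has `s ^ 2 = 1`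
    have hunit : ∀ s : ℤ, (s : GaussianInt) ∣ 1 → s ^ 2 = 1 := by
      intro s hs
      have hs' : s ∣ (1 : ℤ) := (Zsqrtd.intCast_dvd_intCast s 1).mp (by simpa using hs)
      rcases Int.isUnit_iff.mp (isUnit_of_dvd_one hs') with h | h <;> rw [h] <;> norm_num
    rcases Nat.even_or_odd K with hK | hK
    · -- `K` even: `γ + B ∣ γⁿ + Bⁿ = 1 + i`
      left
      have hdiv : γ + B ∣ ⟨1, 1⟩ := by
        have := Odd.add_dvd_pow_add_pow γ B (show Odd (2 * K + 1) from ⟨K, rfl⟩)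
        rw [hK.neg_one_pow, one_mul] at key
        rwa [key] at this
      have hsum : γ + B = ((γ.re + γ.im : ℤ) : GaussianInt) * ⟨1, 1⟩ := by
        ext <;> simp [B]
        ring
      have hw : (⟨1, 1⟩ : GaussianInt) ≠ 0 := by decide
      rw [hsum] at hdiv
      exact hunit _ ((mul_dvd_mul_iff_right hw).mp (by simpa using hdiv))
    · -- `K` odd: `γ - B ∣ γⁿ - Bⁿ = 1 + i = i (1 - i)`
      right
      have hdiv : γ - B ∣ ⟨1, 1⟩ := by
        have := sub_dvd_pow_sub_pow γ B (2 * K + 1)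
        rw [hK.neg_one_pow, neg_one_mul, ← sub_eq_add_neg] at key
        rwa [key] at this
      have hdiff : γ - B = ((γ.re - γ.im : ℤ) : GaussianInt) * ⟨1, -1⟩ := by ext <;> simp [B]
      have h11 : (⟨1, 1⟩ : GaussianInt) = ⟨0, 1⟩ * ⟨1, -1⟩ := by decide
      have hw : (⟨1, -1⟩ : GaussianInt) ≠ 0 := by decide
      rw [hdiff, h11] at hdiv
      have h1 : ((γ.re - γ.im : ℤ) : GaussianInt) ∣ ⟨0, 1⟩ := (mul_dvd_mul_iff_right hw).mp hdiv
      have h2 : ((γ.re - γ.im : ℤ) : GaussianInt) ∣ 1 := by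
        have e : (⟨0, 1⟩ : GaussianInt) * ⟨0, -1⟩ = 1 := by decide
        rw [← e]
        exact dvd_mul_of_dvd_left h1 _
      exact hunit _ h2

/-- **Cohn 1996, Lemma, first half — the shape `2z = c² + 1` (p. 19–20).** If `y² + 1 = 2·zⁿ` with `n` odd
and `z > 0` then `2z = c² + 1` for some integer `c` (namely `c = a ∓ b = 2a ∓ 1` in the notation of
`exists_sq_add_sq_eq_of_sq_add_one_eq_two_mul_pow`, since `(a+b)² + (a−b)² = 2(a²+b²)`).
[cite: Cohn1996PerfectPellPowers, Lemma, p. 19–20] -/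
theorem exists_sq_add_one_eq_two_mul_of_sq_add_one_eq_two_mul_pow {y z : ℤ} {n : ℕ} (hn : Odd n)
    (hz : 0 < z) (h : y ^ 2 + 1 = 2 * z ^ n) : ∃ c : ℤ, c ^ 2 + 1 = 2 * z := by
  obtain ⟨a, b, hz', hab | hab⟩ := exists_sq_add_sq_eq_of_sq_add_one_eq_two_mul_pow hn hz h
  · exact ⟨a - b, by linear_combination (-1 : ℤ) * hab + 2 * hz'⟩
  · exact ⟨a + b, by linear_combination (-1 : ℤ) * hab + 2 * hz'⟩

/-- **(A) of the abc-inputs I-03 skeleton (lead abc-inputs-pr-2, 2026-08-28), signature verbatim.**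
Cohn 1996, Lemma, Gaussian-integer half for the exponent `2K+1`: `y² + 1 = 2·z^{2K+1}`, `z > 0`
⇒ `2z = c² + 1` for some integer `c`. [cite: Cohn1996PerfectPellPowers, Lemma, p. 19–20] -/
theorem cohn_exists_sq_add_one_eq_two_mul {y z : ℤ} {K : ℕ} (hz : 0 < z)
    (h : y ^ 2 + 1 = 2 * z ^ (2 * K + 1)) : ∃ c : ℤ, c ^ 2 + 1 = 2 * z :=
  exists_sq_add_one_eq_two_mul_of_sq_add_one_eq_two_mul_pow ⟨K, rfl⟩ hz h

end Summit.ABC.ABC.Theorems
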